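import Literature.NumberTheory.LFunctions.ZetaDualPhaseFifth
import HarnessLib

/-!
# Two-sided bounds for the fifth derivative of the dual phase on a block

Topic `Literature/NumberTheory/LFunctions`. For the `B`-process dual `ψ` of the differenced
logarithmic phase `φ_r(y) = (t/2π)(log y - log(y + r))` (Patel–Yang 2024, proof of Lemma 3.4), the
fifth-derivative test needs `λ₅ ≤ |ψ⁽⁵⁾(ν)| ≤ h₅λ₅` for the stationary points `x_ν` in a block
`a ≤ x_ν`, `x_ν + r ≤ ha` (Patel–Yang (3.11): `λ₅ = (53632√2π⁴/729) a⁹/(t⁴r⁴) = 104.05… π⁴a⁹/(t⁴r⁴)`,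
`h₅ = (76545√2/107264) h⁹`). From the closed form
`-ψ⁽⁵⁾ = 24Q/(K⁴(p-q)⁴(p+q)⁷)` (`Literature.NumberTheory.LFunctions.VdC.dual_fifth_eq`, `p = 1/y`,
`q = 1/(y+r)`, `K = t/2π`, `Q` a form of degree `6` with positive coefficients summing to `35`,
`p - q = rpq`, `2q ≤ p + q ≤ 2p`, `1/(ha) ≤ q ≤ p ≤ 1/a`) we PROVE the box bounds
`(105/16) a⁹/(h²K⁴r⁴) ≤ -ψ⁽⁵⁾ ≤ h¹³ · (105/16) a⁹/(h²K⁴r⁴)`, i.e. `λ₅' = 105π⁴ a⁹/(h²t⁴r⁴)`,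
`h₅' = h¹³` — the same order with marginally different numerical constants (which enter the final
estimates only through `λ₅^{1/30}` and `h₅^{1/8}`).

## Main results

* `Literature.NumberTheory.LFunctions.VdC.neg_dual_fifth_bounds` — the bounds at a point `y` of the block.
* `Literature.NumberTheory.LFunctions.VdC.neg_dualFamily5_five_bounds` — the bounds for
  `-dualFamily5 t r 5 ν` when `x_ν` lies in the block.

## References

* D. Patel, A. Yang, *An explicit sub-Weyl bound for `ζ(1/2 + it)`*, J. Number Theory 262 (2024),
  proof of Lemma 3.4, (3.8)–(3.11). [cite: PatelYang2024, (3.11)]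
-/

noncomputable section

open Real Set

namespace Literature.NumberTheory.LFunctions
namespace VdC

/-- **Box bounds for `-ψ⁽⁵⁾`** at a point `y` with `a ≤ y`, `y + r ≤ ha` (`0 < a`, `0 < r`,
`1 ≤ h`, `K = t/2π`): `(105/16) a⁹/(h²K⁴r⁴) ≤ 24Q/(K⁴(p-q)⁴(p+q)⁷) ≤ h¹³ (105/16) a⁹/(h²K⁴r⁴)`.
[cite: PatelYang2024, (3.11)] -/
theorem neg_dual_fifth_bounds {t r a h y : ℝ} (ht : 0 < t) (hr : 0 < r) (ha : 0 < a) (hh : 1 ≤ h)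
    (hy : a ≤ y) (hyr : y + r ≤ h * a) :
    105 / 16 * a ^ 9 / (h ^ 2 * (t / (2 * π)) ^ 4 * r ^ 4)
      ≤ 24 * (y⁻¹ ^ 6 + 3 * y⁻¹ ^ 5 * (y + r)⁻¹ + 9 * y⁻¹ ^ 4 * (y + r)⁻¹ ^ 2
          + 9 * y⁻¹ ^ 3 * (y + r)⁻¹ ^ 3 + 9 * y⁻¹ ^ 2 * (y + r)⁻¹ ^ 4 + 3 * y⁻¹ * (y + r)⁻¹ ^ 5
          + (y + r)⁻¹ ^ 6)
        / ((t / (2 * π)) ^ 4 * (y⁻¹ - (y + r)⁻¹) ^ 4 * (y⁻¹ + (y + r)⁻¹) ^ 7)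
    ∧ 24 * (y⁻¹ ^ 6 + 3 * y⁻¹ ^ 5 * (y + r)⁻¹ + 9 * y⁻¹ ^ 4 * (y + r)⁻¹ ^ 2
          + 9 * y⁻¹ ^ 3 * (y + r)⁻¹ ^ 3 + 9 * y⁻¹ ^ 2 * (y + r)⁻¹ ^ 4 + 3 * y⁻¹ * (y + r)⁻¹ ^ 5
          + (y + r)⁻¹ ^ 6)
        / ((t / (2 * π)) ^ 4 * (y⁻¹ - (y + r)⁻¹) ^ 4 * (y⁻¹ + (y + r)⁻¹) ^ 7)
      ≤ h ^ 13 * (105 / 16 * a ^ 9 / (h ^ 2 * (t / (2 * π)) ^ 4 * r ^ 4)) := by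
  have hK : 0 < t / (2 * π) := by positivity
  have hy0 : 0 < y := lt_of_lt_of_le ha hy
  have hyr0 : 0 < y + r := by linarith
  have hh0 : 0 < h := by linarith
  set K : ℝ := t / (2 * π) with hKdef
  set p : ℝ := y⁻¹ with hp
  set q : ℝ := (y + r)⁻¹ with hq
  have hp0 : 0 < p := inv_pos.2 hy0
  have hq0 : 0 < q := inv_pos.2 hyr0
  have hqp : q ≤ p := by rw [hp, hq]; exact inv_anti₀ hy0 (by linarith)
  have hpq : p - q = r * p * q := by
    rw [hp, hq, inv_sub_inv_add_eq hy0 hyr0]; field_simp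
  have hpq0 : 0 < p - q := by rw [hpq]; positivity
  -- `p ≤ 1/a`, `1/(ha) ≤ q`
  have hpa : p ≤ a⁻¹ := by rw [hp]; exact inv_anti₀ ha hy
  have hqa : (h * a)⁻¹ ≤ q := by rw [hq]; exact inv_anti₀ hyr0 hyr
  -- the form `Q`
  set Q : ℝ := p ^ 6 + 3 * p ^ 5 * q + 9 * p ^ 4 * q ^ 2 + 9 * p ^ 3 * q ^ 3 + 9 * p ^ 2 * q ^ 4
    + 3 * p * q ^ 5 + q ^ 6 with hQ
  have hQlo : 35 * q ^ 6 ≤ Q := by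
    rw [hQ]
    have h1 : q ^ 6 ≤ p ^ 6 := pow_le_pow_left₀ hq0.le hqp 6
    have h2 : q ^ 6 ≤ p ^ 5 * q := by
      calc q ^ 6 = q ^ 5 * q := by ring
        _ ≤ p ^ 5 * q := mul_le_mul_of_nonneg_right (pow_le_pow_left₀ hq0.le hqp 5) hq0.le
    have h3 : q ^ 6 ≤ p ^ 4 * q ^ 2 := by
      calc q ^ 6 = q ^ 4 * q ^ 2 := by ring
        _ ≤ p ^ 4 * q ^ 2 := mul_le_mul_of_nonneg_right (pow_le_pow_left₀ hq0.le hqp 4) (by positivity)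
    have h4 : q ^ 6 ≤ p ^ 3 * q ^ 3 := by
      calc q ^ 6 = q ^ 3 * q ^ 3 := by ring
        _ ≤ p ^ 3 * q ^ 3 := mul_le_mul_of_nonneg_right (pow_le_pow_left₀ hq0.le hqp 3) (by positivity)
    have h5 : q ^ 6 ≤ p ^ 2 * q ^ 4 := by
      calc q ^ 6 = q ^ 2 * q ^ 4 := by ring
        _ ≤ p ^ 2 * q ^ 4 := mul_le_mul_of_nonneg_right (pow_le_pow_left₀ hq0.le hqp 2) (by positivity)
    have h6 : q ^ 6 ≤ p * q ^ 5 := by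
      calc q ^ 6 = q * q ^ 5 := by ring
        _ ≤ p * q ^ 5 := mul_le_mul_of_nonneg_right hqp (by positivity)
    linarith
  have hQhi : Q ≤ 35 * p ^ 6 := by
    rw [hQ]
    have h2 : p ^ 5 * q ≤ p ^ 6 := by
      calc p ^ 5 * q ≤ p ^ 5 * p := mul_le_mul_of_nonneg_left hqp (by positivity)
        _ = p ^ 6 := by ring
    have h3 : p ^ 4 * q ^ 2 ≤ p ^ 6 := by
      calc p ^ 4 * q ^ 2 ≤ p ^ 4 * p ^ 2 :=
            mul_le_mul_of_nonneg_left (pow_le_pow_left₀ hq0.le hqp 2) (by positivity)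
        _ = p ^ 6 := by ring
    have h4 : p ^ 3 * q ^ 3 ≤ p ^ 6 := by
      calc p ^ 3 * q ^ 3 ≤ p ^ 3 * p ^ 3 :=
            mul_le_mul_of_nonneg_left (pow_le_pow_left₀ hq0.le hqp 3) (by positivity)
        _ = p ^ 6 := by ring
    have h5 : p ^ 2 * q ^ 4 ≤ p ^ 6 := by
      calc p ^ 2 * q ^ 4 ≤ p ^ 2 * p ^ 4 :=
            mul_le_mul_of_nonneg_left (pow_le_pow_left₀ hq0.le hqp 4) (by positivity)
        _ = p ^ 6 := by ring
    have h6 : p * q ^ 5 ≤ p ^ 6 := by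
      calc p * q ^ 5 ≤ p * p ^ 5 := mul_le_mul_of_nonneg_left (pow_le_pow_left₀ hq0.le hqp 5) hp0.le
        _ = p ^ 6 := by ring
    have h7 : q ^ 6 ≤ p ^ 6 := pow_le_pow_left₀ hq0.le hqp 6
    linarith
  -- `2q ≤ p + q ≤ 2p`
  have hs1 : 2 * q ≤ p + q := by linarith
  have hs2 : p + q ≤ 2 * p := by linarith
  -- rewrite the middle quantity
  have hmid : 24 * (p ^ 6 + 3 * p ^ 5 * q + 9 * p ^ 4 * q ^ 2 + 9 * p ^ 3 * q ^ 3 + 9 * p ^ 2 * q ^ 4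
        + 3 * p * q ^ 5 + q ^ 6) / (K ^ 4 * (p - q) ^ 4 * (p + q) ^ 7)
      = 24 * Q / (K ^ 4 * r ^ 4 * (p * q) ^ 4 * (p + q) ^ 7) := by
    rw [hQ, hpq]; ring
  rw [hmid]
  have hden0 : 0 < K ^ 4 * r ^ 4 * (p * q) ^ 4 * (p + q) ^ 7 := by positivity
  constructor
  · -- lower bound: `Q ≥ 35 q⁶`, `(p+q)^7 ≤ (2p)^7`, `p ≤ 1/a`, `q ≥ 1/(ha)`
    rw [div_le_div_iff₀ (by positivity) hden0]
    -- `105/16 a⁹ · K⁴r⁴(pq)⁴(p+q)⁷ ≤ 24 Q · h²K⁴r⁴`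
    have h1 : (p * q) ^ 4 * (p + q) ^ 7 ≤ (p * q) ^ 4 * (2 * p) ^ 7 :=
      mul_le_mul_of_nonneg_left (pow_le_pow_left₀ (by positivity) hs2 7) (by positivity)
    -- `p^{11} q^4 a^9 ≤ h² q^6 · (35·24/ (105/16 · 128))`: use `p ≤ 1/a` and `1 ≤ h a q`
    have hpa' : p * a ≤ 1 := by
      have := mul_le_mul_of_nonneg_right hpa ha.le
      rwa [inv_mul_cancel₀ ha.ne'] at this
    have hqa' : 1 ≤ h * a * q := by
      have := mul_le_mul_of_nonneg_left hqa (by positivity : 0 ≤ h * a)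
      rwa [mul_inv_cancel₀ (by positivity : h * a ≠ 0)] at this
    -- `(pa)^{11} ≤ 1` and `(haq)^2 ≥ 1`
    have hpa11 : (p * a) ^ 11 ≤ 1 := pow_le_one₀ (by positivity) hpa'
    have hqa2 : 1 ≤ (h * a * q) ^ 2 := one_le_pow₀ hqa'
    -- assemble
    have key : 105 / 16 * a ^ 9 * (K ^ 4 * r ^ 4 * ((p * q) ^ 4 * (2 * p) ^ 7))
        ≤ 24 * (35 * q ^ 6) * (h ^ 2 * K ^ 4 * r ^ 4) := by
      -- both sides `= 840 K⁴ r⁴ q⁴ × …`: compare `p^{11} a^9` with `h² q²`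
      have e1 : 105 / 16 * a ^ 9 * (K ^ 4 * r ^ 4 * ((p * q) ^ 4 * (2 * p) ^ 7))
          = 840 * (K ^ 4 * r ^ 4 * q ^ 4) * ((p * a) ^ 9 * p ^ 2) := by ring
      have e2 : 24 * (35 * q ^ 6) * (h ^ 2 * K ^ 4 * r ^ 4)
          = 840 * (K ^ 4 * r ^ 4 * q ^ 4) * (h ^ 2 * q ^ 2) := by ring
      rw [e1, e2]
      refine mul_le_mul_of_nonneg_left ?_ (by positivity)
      -- `(pa)^9 p² ≤ h² q²`: `(pa)^9 ≤ 1` and `p² ≤ h²q²·`? No: use `p a ≤ 1 ≤ h a q` so `p ≤ h q`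
      have hphq : p ≤ h * q := by nlinarith
      have h9 : (p * a) ^ 9 ≤ 1 := pow_le_one₀ (by positivity) hpa'
      calc (p * a) ^ 9 * p ^ 2 ≤ 1 * p ^ 2 := mul_le_mul_of_nonneg_right h9 (by positivity)
        _ = p ^ 2 := one_mul _
        _ ≤ (h * q) ^ 2 := pow_le_pow_left₀ hp0.le hphq 2
        _ = h ^ 2 * q ^ 2 := by ring
    calc 105 / 16 * a ^ 9 * (K ^ 4 * r ^ 4 * (p * q) ^ 4 * (p + q) ^ 7)
        = 105 / 16 * a ^ 9 * (K ^ 4 * r ^ 4 * ((p * q) ^ 4 * (p + q) ^ 7)) := by ring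
      _ ≤ 105 / 16 * a ^ 9 * (K ^ 4 * r ^ 4 * ((p * q) ^ 4 * (2 * p) ^ 7)) :=
          mul_le_mul_of_nonneg_left (mul_le_mul_of_nonneg_left h1 (by positivity)) (by positivity)
      _ ≤ 24 * (35 * q ^ 6) * (h ^ 2 * K ^ 4 * r ^ 4) := key
      _ ≤ 24 * Q * (h ^ 2 * K ^ 4 * r ^ 4) :=
          mul_le_mul_of_nonneg_right (mul_le_mul_of_nonneg_left hQlo (by norm_num)) (by positivity)
  · -- upper bound: `Q ≤ 35 p⁶`, `(p+q)^7 ≥ (2q)^7`, `p ≤ 1/a`, `q ≥ 1/(ha)`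
    rw [div_le_iff₀ hden0]
    have hpa' : p * a ≤ 1 := by
      have := mul_le_mul_of_nonneg_right hpa ha.le
      rwa [inv_mul_cancel₀ ha.ne'] at this
    have hqa' : 1 ≤ h * a * q := by
      have := mul_le_mul_of_nonneg_left hqa (by positivity : 0 ≤ h * a)
      rwa [mul_inv_cancel₀ (by positivity : h * a ≠ 0)] at this
    have h1 : (p * q) ^ 4 * (2 * q) ^ 7 ≤ (p * q) ^ 4 * (p + q) ^ 7 :=
      mul_le_mul_of_nonneg_left (pow_le_pow_left₀ (by positivity) hs1 7) (by positivity)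
    -- `24·35 p⁶ ≤ h^{13}·(105/16) a⁹/(h²K⁴r⁴) · K⁴r⁴(pq)⁴(2q)^7 = 840 h^{11} a^9 p^4 q^{11}`
    have key : 24 * (35 * p ^ 6) ≤ h ^ 13 * (105 / 16 * a ^ 9 / (h ^ 2 * K ^ 4 * r ^ 4))
        * (K ^ 4 * r ^ 4 * ((p * q) ^ 4 * (2 * q) ^ 7)) := by
      have e2 : h ^ 13 * (105 / 16 * a ^ 9 / (h ^ 2 * K ^ 4 * r ^ 4)) * (K ^ 4 * r ^ 4 * ((p * q) ^ 4 * (2 * q) ^ 7))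
          = 840 * p ^ 4 * ((h * a * q) ^ 11 * (a⁻¹) ^ 2) := by
        field_simp
        ring
      rw [e2, show 24 * (35 * p ^ 6) = 840 * p ^ 4 * p ^ 2 by ring]
      refine mul_le_mul_of_nonneg_left ?_ (by positivity)
      have h11 : 1 ≤ (h * a * q) ^ 11 := one_le_pow₀ hqa'
      have h2 : p ^ 2 ≤ (a⁻¹) ^ 2 := pow_le_pow_left₀ hp0.le hpa 2
      calc p ^ 2 ≤ (a⁻¹) ^ 2 := h2
        _ = 1 * (a⁻¹) ^ 2 := (one_mul _).symm
        _ ≤ (h * a * q) ^ 11 * (a⁻¹) ^ 2 := mul_le_mul_of_nonneg_right h11 (by positivity)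
    calc 24 * Q ≤ 24 * (35 * p ^ 6) := mul_le_mul_of_nonneg_left hQhi (by norm_num)
      _ ≤ h ^ 13 * (105 / 16 * a ^ 9 / (h ^ 2 * K ^ 4 * r ^ 4)) * (K ^ 4 * r ^ 4 * ((p * q) ^ 4 * (2 * q) ^ 7)) := key
      _ ≤ h ^ 13 * (105 / 16 * a ^ 9 / (h ^ 2 * K ^ 4 * r ^ 4)) * (K ^ 4 * r ^ 4 * (p * q) ^ 4 * (p + q) ^ 7) := by
          rw [show K ^ 4 * r ^ 4 * (p * q) ^ 4 * (p + q) ^ 7 = K ^ 4 * r ^ 4 * ((p * q) ^ 4 * (p + q) ^ 7) by ring]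
          exact mul_le_mul_of_nonneg_left (mul_le_mul_of_nonneg_left h1 (by positivity)) (by positivity)

/-- **Bounds for `-ψ⁽⁵⁾(ν)` on a block**: if the stationary point `x_ν` satisfies `a ≤ x_ν` and
`x_ν + r ≤ ha` then `λ₅' ≤ -dualFamily5 t r 5 ν ≤ h¹³λ₅'`, `λ₅' = (105/16) a⁹/(h²K⁴r⁴)`.
[cite: PatelYang2024, (3.11)] -/
theorem neg_dualFamily5_five_bounds {t r a h ν : ℝ} (ht : 0 < t) (hr : 0 < r) (ha : 0 < a) (hh : 1 ≤ h)
    (hν : 0 < ν) (hx : a ≤ xsLog t r ν) (hxr : xsLog t r ν + r ≤ h * a) :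
    105 / 16 * a ^ 9 / (h ^ 2 * (t / (2 * π)) ^ 4 * r ^ 4) ≤ -dualFamily5 t r 5 ν
    ∧ -dualFamily5 t r 5 ν ≤ h ^ 13 * (105 / 16 * a ^ 9 / (h ^ 2 * (t / (2 * π)) ^ 4 * r ^ 4)) := by
  have hxpos := xsLog_pos ht hr hν
  rw [dualFamily5_five, dual_fifth_eq ht hxpos hr, neg_div, neg_neg]
  exact neg_dual_fifth_bounds ht hr ha hh hx hxr

end VdC
end Literature.NumberTheory.LFunctions
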